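import Summits.QuantumFields.YangMills.Theorems.BalabanUVNodesN21ThresholdMixture

/-!
# YM-DAG node N21 (= NE7c) — THE THRESHOLD MIXTURE, PART 2: the constructor `termRepr_of_sharpMixture` — pv07's `T4LipschitzLedger.TermRepr`
# with `χ_a = linProfile κ_a` for the normalised threshold average of a THRESHOLD-FREE sharp representation (lens ROW A (β))

Track A of `YM-PLAN.md` (cell `pub-ymgap`, HUMAN RULING D-0062), node **N21**; R141 (C) fan-out seat `pub-ymgap-dag-n21-e` (s3 = ALTERNATIVE
CURRENCY), generation 2, file 5b — companion of file 5a `BalabanUVNodesN21ThresholdMixture` (the lens lemmas: profile = threshold average, the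
wall (M1) for the mixture by Fubini in the threshold, the per-term product identity; and the linear transports).  ROW A (β) of
`ym-lens-BalabanUVNodes-nearmiss/LENS-nearmiss.md` v2.0 §4 (pub-ymgap INBOX l.13275; dag-lead DEDUP-179 l.13306, GO l.≥13562).  Kernel
bookkeeping + ONE Fubini swap: 0 `def`, 0 `sorry`, standard axioms.  COUNT-NEUTRAL; `--supports` the K3′ item `SpineGivenEndpointR12` as a helper.

HONEST FRAMING.  NE7c (`T4IndicatorShell.ShellWeightBound`) is NOT PRINTED in [Bałaban 1983–89] and NOT PROVED; print constructs ONE run with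
thresholds fixed once.  Here: IF the record's term weights, AS A FUNCTION OF A FREE THRESHOLD VECTOR, have the sharp shape `hXs` below
(located input (O-mix-1): NODE O's instantiation at the Stage-12 record; def-T∕def-χ typing question «is the threshold a free argument of
`Node00.chiOfRecord`, read nowhere else?» — the card's cheapest falsifier (K-ii)), THEN the λ-AVERAGED carriers satisfy design (η)'s realized
ledger `T4LipschitzLedger.TermRepr` with the piecewise-linear profiles `linProfile κ_a`, `L_a = κ_a⁻¹` — so files 2∕3 of this seat
(`…N21AtSpineCarriersProfiledRealized.n21_knit_repr` ∕ `s_N21_of_reprReading`, `…ProfiledThresholdSync.s_N21_of_twoThresholdReprReading`) apply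
BY NAME with NO profiled tower of record.  The other binders of those knits — `SupClose` (N16, (F∞)) and `SiblingSuppression` (N20, NE7b
species), uniform over multipliers in `[1 − κ_a, 1]` (O-mix-2) — are untouched; ONE multiplier per OCCURRENCE (O-mix-3).  Not print's
construction verbatim (a convex combination of print's sharp procedure over admissible threshold vectors); N21 NOT discharged; one finite
four-torus programme at fixed `ε`; NOT continuum ∕ ℝ⁴ ∕ OS ∕ mass gap ∕ Clay.

CITATION HEADER (lean-in-tree rule 2026-08-18).  Everything BY NAME from the tree: file 5a (`sharpMixture_prod_eq_profile_prod`),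
`T4IndicatorShell.smallInd` ∕ `smallInd_nonneg` ∕ `smallInd_le_one`, `T4LipschitzCutoff.linProfile` ∕ `linProfile_lipProfile`, `T4LipschitzLedger.Pol`
∕ `Pol.fac` ∕ `Pol.fac_nonneg` ∕ `Pol.fac_le_one` ∕ `Pol.measurable_fac` ∕ `facAt` ∕ `TermRepr`; Mathlib `integral_integral_swap`, `Integrable.comp_snd`,
`Integrable.mono'`, `Finset.measurable_prod`, `Finset.prod_range`, `integral_mul_const`, `integral_const_mul`.  Context only (SHAPE, no sentence a
hypothesis): [Balaban1988Convergent] (2.17)∕(2.18) p. 257 (sharp small-field slots at `ε_kη²`; the density as a sum of terms).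

WHAT IS PROVED ([folklore]).  `prod_fac_smallInd_mem_unitInterval` · `measurable_smallInd_eval` · `measurable_prod_fac_smallInd` ·
`sharpMixture_prod_range_eq` (file 5a's product identity in `TermRepr.repr`'s `range`∕`facAt` letters) · `integrable_sharpIntegrand` (joint
integrability on `pi ⊗ μ`) · `mixture_repr` (ONE Fubini swap: the normalised threshold average of a threshold-free sharp weight EQUALS the
profiled weight) · **`termRepr_of_sharpMixture`**.
-/

set_option autoImplicit false

noncomputable section

open MeasureTheory Set
open scoped BigOperators ENNReal

namespace Summit.QuantumFields.YangMills.Theorems.N21ThresholdMixtureRepr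

open Literature.MathematicalPhysics.QuantumFieldTheory.Balaban1983to89
open Literature.MathematicalPhysics.QuantumFieldTheory.Balaban1983to89.T4LipschitzCutoff
open Literature.MathematicalPhysics.QuantumFieldTheory.Balaban1983to89.T4IndicatorShell
open Literature.MathematicalPhysics.QuantumFieldTheory.Balaban1983to89.T4LipschitzLedger
open Summit.QuantumFields.YangMills.Theorems.N21ThresholdMixture (sharpMixture_prod_eq_profile_prod)

/-! ## §1 ROW A (β): the constructor `termRepr_of_sharpMixture` — pv07's `TermRepr` for the λ-averages of a threshold-free sharp representation

Dictionary (binders of the theorems, never discharged here).  ONE run; its terms `τ ∈ T K` at source `t`, `|t| ≤ l₀`.  The SHARP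
representation of the record (located input (O-mix-1), NODE O): on a measurable space `Ω K τ` with reference measure `μ K τ` — the term's
integration variables —, the term's `m K τ` background-mediated characteristic-function factors are SHARP indicators `1[u_i < s_i]` of
polarity `pol K τ i` (small `χ` ∕ large `1 − χ`) in MEASURABLE tested variables `uX K τ i` at a FREE threshold vector
`s : Fin (m K τ) → ℝ`, times a NONNEGATIVE INTEGRABLE remainder `RX K t τ` (everything else: actions, fluctuation weights, pending
operations, the observable insert) that does NOT read `s`; the weight is `Xs K t τ s = ∫ (∏_i (pol i).fac (1[uX_i v < s_i])) · RX v ∂μ`.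
Print's term is `Xs` at ONE threshold vector `s_i = θ K τ i` ([Balaban1988Convergent] (2.17): `ε_kη²`); the MIXTURE carrier is the
normalised average `X K t τ = (∏_i (κ_{a_i} θ_i))⁻¹ · ∫ Xs K t τ s ∂(⊗_i Leb|[(1 − κ_{a_i})θ_i, θ_i])`, `a_i = (slot K τ i).1` the factor's
age, `0 < κ_a < 1` the admissible relative width of age `a` (`T4LipschitzCutoff` §5∕§7).  The other run's tested variables `uY` on the same
space (node U5a's coupling) enter only through `TermRepr.meas`. -/

section Constructor

/-- a product of sharp slot factors lies in `[0, 1]`. [folklore] -/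
theorem prod_fac_smallInd_mem_unitInterval {m : ℕ} (pol : Fin m → Pol) (u s : Fin m → ℝ) :
    0 ≤ ∏ i, (pol i).fac (smallInd (u i) (s i)) ∧ ∏ i, (pol i).fac (smallInd (u i) (s i)) ≤ 1 :=
  ⟨Finset.prod_nonneg fun _ _ => Pol.fac_nonneg (smallInd_nonneg _ _) (smallInd_le_one _ _) _,
    Finset.prod_le_one (fun _ _ => Pol.fac_nonneg (smallInd_nonneg _ _) (smallInd_le_one _ _) _)
      fun _ _ => Pol.fac_le_one (smallInd_nonneg _ _) (smallInd_le_one _ _) _⟩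

variable {Y : Type*} [MeasurableSpace Y]

/-- the sharp indicator `1[u v < s]` is jointly measurable in (threshold vector, field) for a measurable tested variable. [folklore] -/
theorem measurable_smallInd_eval {m : ℕ} {u : Y → ℝ} (hu : Measurable u) (i : Fin m) :
    Measurable fun p : (Fin m → ℝ) × Y => smallInd (u p.2) (p.1 i) := by
  unfold smallInd
  refine Measurable.ite ?_ measurable_const measurable_const
  exact measurableSet_lt (hu.comp measurable_snd) ((measurable_pi_apply i).comp measurable_fst)

/-- … hence so is the product of the sharp slot factors of a term. [folklore] -/
theorem measurable_prod_fac_smallInd {m : ℕ} (pol : Fin m → Pol) {u : Fin m → Y → ℝ} (hu : ∀ i, Measurable (u i)) :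
    Measurable fun p : (Fin m → ℝ) × Y => ∏ i, (pol i).fac (smallInd (u i p.2) (p.1 i)) := by
  refine Finset.measurable_prod _ fun i _ => ?_
  exact (Pol.measurable_fac (pol i)).comp (measurable_smallInd_eval (hu i) i)

/-- **FILE 5a's PER-TERM IDENTITY IN `TermRepr.repr`'s LETTERS.**  With the profiles `χ_a = linProfile (κ a)` indexed by AGE and the term's
factor `i < m` of age `(sl i).1`, polarity `pol i`, threshold `θ i > 0`, tested value `u i`: the average of the sharp product over the
threshold box is `(∏_{i<m} κ_{a_i}θ_i) · ∏_{i ∈ range m} facAt χ sl pol θ u i`. [folklore] -/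
theorem sharpMixture_prod_range_eq (κ : ℕ → ℝ) {m : ℕ} (sl : ℕ → Σ _ : ℕ, ℕ) (pol : ℕ → Pol) (θ u : ℕ → ℝ)
    (hκ0 : ∀ i < m, 0 < κ (sl i).1) (hθ : ∀ i < m, 0 < θ i) :
    ∫ s : Fin m → ℝ, ∏ i : Fin m, (pol i).fac (smallInd (u i) (s i))
        ∂(Measure.pi fun i : Fin m => volume.restrict (Icc ((1 - κ (sl i).1) * θ i) (θ i)))
      = (∏ i : Fin m, (κ (sl i).1 * θ i)) *
          ∏ i ∈ Finset.range m, facAt (fun a => linProfile (κ a)) sl pol θ u i := by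
  rw [sharpMixture_prod_eq_profile_prod (fun i : Fin m => pol i) (fun i : Fin m => κ (sl i).1) (fun i : Fin m => θ i)
      (fun i : Fin m => u i) (fun i => hκ0 i i.2) (fun i => hθ i i.2), Finset.prod_mul_distrib,
    Finset.prod_range fun i => facAt (fun a => linProfile (κ a)) sl pol θ u i]
  rfl

/-- **JOINT INTEGRABILITY OF THE SHARP INTEGRAND** on `(threshold box) × (field space)`: the product of sharp slot factors is measurable
with values in `[0, 1]`, the remainder is integrable and the box has finite Lebesgue measure. [folklore] -/
theorem integrable_sharpIntegrand {m : ℕ} (μ : Measure Y) [SFinite μ] (pol : Fin m → Pol) {u : Fin m → Y → ℝ}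
    (hu : ∀ i, Measurable (u i)) {R : Y → ℝ} (hR : Integrable R μ) (lo hi : Fin m → ℝ) :
    Integrable (Function.uncurry fun (s : Fin m → ℝ) (v : Y) => (∏ i, (pol i).fac (smallInd (u i v) (s i))) * R v)
      ((Measure.pi fun i : Fin m => volume.restrict (Icc (lo i) (hi i))).prod μ) := by
  have hR2 : Integrable (fun p : (Fin m → ℝ) × Y => R p.2)
      ((Measure.pi fun i : Fin m => volume.restrict (Icc (lo i) (hi i))).prod μ) :=
    hR.comp_snd (Measure.pi fun i : Fin m => volume.restrict (Icc (lo i) (hi i)))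
  refine hR2.norm.mono' ((measurable_prod_fac_smallInd pol hu).aestronglyMeasurable.mul hR2.aestronglyMeasurable)
    (ae_of_all _ fun p => ?_)
  obtain ⟨s, v⟩ := p
  have h01 := prod_fac_smallInd_mem_unitInterval pol (fun i => u i v) s
  show ‖(∏ i, (pol i).fac (smallInd (u i v) (s i))) * R v‖ ≤ ‖R v‖
  rw [norm_mul, Real.norm_of_nonneg h01.1]
  exact mul_le_of_le_one_left (norm_nonneg _) h01.2

/-- **THE MIXTURE IDENTITY (one Fubini swap).**  For a threshold-free sharp weight `s ↦ ∫ (∏_i fac_i(1[u_i v < s_i])) · R v ∂μ`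
(`u_i` measurable, `R` integrable, `θ_i > 0`, `0 < κ_{a_i}`), its NORMALISED average over the threshold box
`⊗_i Leb|[(1 − κ_{a_i})θ_i, θ_i]` equals the PROFILED weight `∫ (∏_{i ∈ range m} facAt (linProfile ∘ κ) sl pol θ (u · v) i) · R v ∂μ`. [folklore] -/
theorem mixture_repr {m : ℕ} (μ : Measure Y) [SFinite μ] (κ : ℕ → ℝ) (sl : ℕ → Σ _ : ℕ, ℕ) (pol : ℕ → Pol) (θ : ℕ → ℝ)
    (u : ℕ → Y → ℝ) (R : Y → ℝ) (hκ0 : ∀ i < m, 0 < κ (sl i).1) (hθ : ∀ i < m, 0 < θ i)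
    (hu : ∀ i < m, Measurable (u i)) (hR : Integrable R μ) :
    (∏ i : Fin m, (κ (sl i).1 * θ i))⁻¹ *
        ∫ s, (∫ v, (∏ i : Fin m, (pol i).fac (smallInd (u i v) (s i))) * R v ∂μ)
          ∂(Measure.pi fun i : Fin m => volume.restrict (Icc ((1 - κ (sl i).1) * θ i) (θ i)))
      = ∫ v, (∏ i ∈ Finset.range m, facAt (fun a => linProfile (κ a)) sl pol θ (fun j => u j v) i) * R v ∂μ := by
  set c : ℝ := ∏ i : Fin m, (κ (sl i).1 * θ i) with hc
  have hcpos : 0 < c := Finset.prod_pos fun i _ => mul_pos (hκ0 i i.2) (hθ i i.2)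
  -- Fubini
  have hswap := integral_integral_swap
    (integrable_sharpIntegrand μ (fun i : Fin m => pol i) (u := fun i => u i) (fun i => hu i i.2) hR
      (fun i => (1 - κ (sl i).1) * θ i) (fun i => θ i))
  rw [hswap]
  -- the inner threshold integral, pointwise in the field
  have hinner : (fun v => ∫ s, (∏ i : Fin m, (pol i).fac (smallInd (u i v) (s i))) * R v
      ∂(Measure.pi fun i : Fin m => volume.restrict (Icc ((1 - κ (sl i).1) * θ i) (θ i)))) =
      fun v => c * ((∏ i ∈ Finset.range m, facAt (fun a => linProfile (κ a)) sl pol θ (fun j => u j v) i) * R v) := by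
    funext v
    rw [integral_mul_const, sharpMixture_prod_range_eq κ sl pol θ (fun j => u j v) hκ0 hθ, hc]
    ring
  rw [hinner, integral_const_mul, ← mul_assoc, inv_mul_cancel₀ hcpos.ne', one_mul]

variable {ι : Type*} {Ω : ℕ → ι → Type*} [∀ K τ, MeasurableSpace (Ω K τ)]

/-- **ROW A (β): `TermRepr` FOR THE THRESHOLD MIXTURE OF A SHARP REPRESENTATION.**  Data of ONE run: term families `T`, source bound `l₀`,
window `N`, counts `n`, per term a space `Ω K τ` with an s-finite measure `μ K τ`, `m K τ` factors with slots `slot K τ i` (age ≤ `min(N, K)`, copy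
`< n a`), polarities `pol`, thresholds `θ K τ i > 0`, measurable tested variables `uX` (this run) ∕ `uY` (the other run), a nonnegative
integrable threshold-free remainder `RX K t τ`; admissible widths `0 < κ a < 1` per age.  HYPOTHESES: (O-mix-1) `hXs` — the SHARP weights
`Xs K t τ s` have the threshold-free representation above for EVERY threshold vector `s`; `hX` — the carriers `X K t τ` ARE the normalised
averages of `Xs K t τ` over `⊗_i Leb|[(1 − κ_{a_i})θ_i, θ_i]`.  CONCLUSION: pv07's
`TermRepr l₀ T X (fun a => linProfile (κ a)) κ (fun a => (κ a)⁻¹) N n μ m slot pol θ uX uY RX` — so the (η) road's realized knits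
(`…N21AtSpineCarriersProfiledRealized.n21_knit_repr`, `s_N21_of_reprReading`; `…ProfiledThresholdSync.s_N21_of_twoThresholdReprReading`)
apply BY NAME to λ-averages of the EXISTING sharp record, with NO profiled tower of record (`profile` = `linProfile_lipProfile`, `repr` =
`mixture_repr`).  Nothing of Bałaban's is asserted; `hXs` is NODE O's instantiation at the Stage-12 record. [folklore] -/
theorem termRepr_of_sharpMixture {l₀ : ℝ} {T : ℕ → Finset ι} {X : ℕ → ℝ → ι → ℝ} {κ : ℕ → ℝ} {N : ℕ} {n : ℕ → ℕ}
    {μ : (K : ℕ) → (τ : ι) → Measure (Ω K τ)} [∀ K τ, SFinite (μ K τ)] {m : ℕ → ι → ℕ}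
    {slot : ℕ → ι → ℕ → Σ _ : ℕ, ℕ} {pol : ℕ → ι → ℕ → Pol} {θ : ℕ → ι → ℕ → ℝ}
    {uX uY : (K : ℕ) → (τ : ι) → ℕ → Ω K τ → ℝ} {RX : (K : ℕ) → ℝ → (τ : ι) → Ω K τ → ℝ}
    (Xs : (K : ℕ) → ℝ → (τ : ι) → (Fin (m K τ) → ℝ) → ℝ) (hκ : ∀ a, 0 < κ a ∧ κ a < 1)
    (thr_pos : ∀ K, ∀ τ ∈ T K, ∀ i < m K τ, 0 < θ K τ i)
    (slot_mem : ∀ K, ∀ τ ∈ T K, ∀ i < m K τ, slot K τ i ∈ (Finset.range (N + 1)).sigma fun a => Finset.range (n a))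
    (slot_band : ∀ K, ∀ τ ∈ T K, ∀ i < m K τ, (slot K τ i).1 ≤ K)
    (meas : ∀ K, ∀ τ ∈ T K, ∀ i < m K τ, Measurable (uX K τ i) ∧ Measurable (uY K τ i))
    (rem_nonneg : ∀ K t, |t| ≤ l₀ → ∀ τ ∈ T K, 0 ≤ᵐ[μ K τ] RX K t τ)
    (rem_int : ∀ K t, |t| ≤ l₀ → ∀ τ ∈ T K, Integrable (RX K t τ) (μ K τ))
    (hXs : ∀ K t, |t| ≤ l₀ → ∀ τ ∈ T K, ∀ s : Fin (m K τ) → ℝ,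
      Xs K t τ s = ∫ v, (∏ i : Fin (m K τ), (pol K τ i).fac (smallInd (uX K τ i v) (s i))) * RX K t τ v ∂(μ K τ))
    (hX : ∀ K t, |t| ≤ l₀ → ∀ τ ∈ T K, X K t τ =
      (∏ i : Fin (m K τ), (κ (slot K τ i).1 * θ K τ i))⁻¹ *
        ∫ s, Xs K t τ s ∂(Measure.pi fun i : Fin (m K τ) =>
          volume.restrict (Icc ((1 - κ (slot K τ i).1) * θ K τ i) (θ K τ i)))) :
    TermRepr l₀ T X (fun a => linProfile (κ a)) κ (fun a => (κ a)⁻¹) N n μ m slot pol θ uX uY RX where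
  profile a := linProfile_lipProfile (hκ a).1 (hκ a).2
  thr_pos := thr_pos
  slot_mem := slot_mem
  slot_band := slot_band
  meas := meas
  rem_nonneg := rem_nonneg
  rem_int := rem_int
  repr K t ht τ hτ := by
    rw [hX K t ht τ hτ]
    simp_rw [hXs K t ht τ hτ]
    exact mixture_repr (μ K τ) κ (slot K τ) (pol K τ) (θ K τ) (uX K τ) (RX K t τ) (fun i _ => (hκ _).1)
      (thr_pos K τ hτ) (fun i hi => (meas K τ hτ i hi).1) (rem_int K t ht τ hτ)

end Constructor

end Summit.QuantumFields.YangMills.Theorems.N21ThresholdMixtureRepr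

end
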